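import Literature.Computability.QuantumComplexity.TruncatedStateFidelity
import Mathlib.Analysis.MeanInequalities
import Mathlib.Analysis.MeanInequalitiesPow
import Mathlib.Analysis.SpecialFunctions.BinaryEntropy
import Mathlib.Analysis.SpecialFunctions.Log.NegMulLog
import Mathlib.Analysis.Convex.Jensen
import HarnessLib

/-!
# Truncation error of a Schmidt spectrum versus its Rényi / von Neumann entropy
  (Verstraete–Cirac 2006, Lemma 2; Schuch–Wolf–Verstraete–Cirac 2008, eqs. (4)–(5))

Topic `Literature/Computability/QuantumComplexity` (pub-qadeq lane; companion of
`TruncatedStateFidelity.lean`, whose `keptWeight` / `discardedWeight` are the quantities bounded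
here). HONEST FRAMING: instance-level adjudication of specific advantage claims; no claim about
BQP vs BPP or the summit. Nothing in this file says that any particular state has any particular
entropy; it fixes, once, the printed arithmetic that converts a block ENTROPY into a statement about
the bond dimension `D` a matrix-product state needs (or may use) at that cut, and conversely.

## Setting (the spectral = classical core of the cited statements)

A finite probability vector `p : ι → ℝ` (`0 ≤ pᵢ`, `Σᵢ pᵢ = 1`): the spectrum `λ^{[k]}` of the
reduced density operator `ρ_k` of a pure state across one cut [cite: SchuchEtAl2008, before eq. (4):
'let λ₁ ≥ λ₂ ≥ ⋯ be the ordered spectrum of ρ_k'], equivalently the squared Schmidt coefficients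
`‖c_k‖²` of `TruncatedStateFidelity` (`keptWeight`, `discardedWeight`). A kept index set
`K : Finset ι` of size `D = #K`; `IsTopSet p K` says that `K` keeps the LARGEST entries (every
discarded value is `≤` every kept value), so that `Σ_{i ∉ K} pᵢ` is the printed truncation error
`ε(D) = Σ_{i > D} λᵢ` of the nonincreasingly ordered spectrum [cite: VerstraeteCirac2006, §3.1
before Lemma 2; SchuchEtAl2008, definition of ε_k(D)]. Entropies (natural logarithm; the sources use
`log₂` resp. an unspecified base — every inequality below is base-covariant because `S_α` and the
logarithms on the other side scale together):

* `powerSum p α = Σᵢ pᵢ^α` (`= tr ρ^α` on the spectrum), `renyiEnt p α = log (Σᵢ pᵢ^α) / (1 − α)`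
  [cite: SchuchEtAl2008, display 'S_α(ρ) = log tr ρ^α / (1 − α), 0 ≤ α ≤ ∞';
  VerstraeteCirac2006, §3.1 display before Lemma 2];
* `shannonEnt p = Σᵢ η(pᵢ)`, `η(t) = −t log t` (`Real.negMulLog`), the von Neumann entropy
  `S(ρ) = −tr ρ log ρ` on the spectrum [cite: SchuchEtAl2008, 'S(ρ) = −tr[ρ log ρ]']; for a
  Hermitian matrix `ρ`, `Literature.InformationTheory.Entropy.vonNeumannEntropy ρ` is by definition
  (`vonNeumannEntropy_eq`) `shannonEnt` of its eigenvalue vector (that module is not imported here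
  to keep this file's imports inside the pub-qadeq cone).

## Contents (all proved, 0 named facts)

* `IsTopSet`, `exists_isTopSet_card` (a top set of every size `D ≤ |ι|` exists),
  `sum_le_sum_of_isTopSet` / `tail_isTopSet_le_tail` — keeping the `D` largest weights maximises the
  kept weight among all sets of `≤ D` indices (so `ε(D)` is the least discarded weight at rank `D`)
  [cite: SchuchEtAl2008, before eq. (4): 'the best an MPS with bond dimension D … can do is to
  preserve the D largest eigenvalues, resulting in an error of ε_k(D)'].
* `tail_le_l1Dist_of_support_card_le` — the classical core of [cite: SchuchEtAl2008, eq. (4) and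
  the chain of inequalities after it] (`‖ψ − φ_D‖_tr ≥ ‖ρ_k − σ_{D,k}‖_tr ≥ ε_k(D)` for
  `rank σ_{D,k} ≤ D`): in the commuting case to
  which step (ii) of the printed proof reduces it, ANY vector `q` supported on at most `D` indices
  is at `ℓ¹`-distance `≥ ε(D)` from `p`. (Steps (i) contractivity of the partial trace and (ii)
  Mirsky's extremality of commuting spectra are NOT formalised here.)
* `keptMass_rpow_div_le_sum_rpow`, `powerSum_ge_two_blocks`, **`log_card_ge_renyiEnt_add`** —
  for `1 < α` and ANY kept set `K` of size `D` with kept weight `P = 1 − ε`: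
  `Σᵢ pᵢ^α ≥ (1−ε)^α / D^{α−1} + ε^α / (n − D)^{α−1} ≥ (1−ε)^α / D^{α−1}`, hence
  `S_α(p) ≤ log D − (α/(α−1)) log (1 − ε)`, i.e. `log D ≥ S_α(p) + (α/(α−1)) log (1 − ε)`
  [cite: SchuchEtAl2008, the two displays after 'Rényi entropies are Schur concave functions',
  α > 1 paragraph following eq. (5)]; exponential form `card_ge_exp_renyiEnt_mul`
  (`D ≥ e^{S_α} (1−ε)^{α/(α−1)}`, e.g. `D ≥ e^{S₂}(1−ε)²`). The printed line
  'log D ≥ S_α + (α/(α−1))|log(1−δ)|' carries the modulus with the wrong sign relative to the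
  display it is derived from; we prove the derived
  inequality (with `+ (α/(α−1)) log(1−ε) = − (α/(α−1))|log(1−ε)|`), which is what the paper's
  conclusion ('D has to grow exponentially') uses.
* **`tail_rpow_mul_card_rpow_le`** (Verstraete–Cirac Lemma 2, multiplicative form) — for
  `0 < α < 1` and a TOP set `K` of size `D ≥ 1` with tail `ε = Σ_{i∉K} pᵢ`:
  `ε^α · D^{1−α} ≤ (1−α)^{1−α} α^α · Σᵢ pᵢ^α` [cite: VerstraeteCirac2006, Lemma 2, proof:
  'Σᵢ pᵢ^α ≥ D h^α + p h^{α−1} ≥ D^{1−α} p^α / ((1−α)^{1−α} α^α)']; logarithmic forms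
  `log_tail_le_sharp` (`log ε ≤ ((1−α)/α)(S_α − log (D/(1−α))) + log α`) and the printed
  **`log_tail_le`**: `log ε(D) ≤ ((1−α)/α) (S_α(ρ) − log (D/(1−α)))`
  [cite: VerstraeteCirac2006, Lemma 2] (the paper drops the term `log α ≤ 0`).
  Our proof replaces the majorisation step by the direct estimate with the threshold
  `h = min_{K} p` (kept entries `≥ h`, discarded `≤ h`) followed by the weighted AM–GM inequality
  at the optimal `h`, which is the paper's 'minimizing this expression with relation to h'.
* `sum_negMulLog_le` (one block: `Σ_{i∈K} η(pᵢ) ≤ P log #K + η(P)`, i.e. `H ≤ log d` for the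
  conditional distribution on the block [cite: NielsenChuang2010, Thm 11.2, p. 506]),
  `shannonEnt_le_log_card_of_support` (`S ≤ log #supp` [cite: NielsenChuang2010, Thm 11.8 (2),
  p. 513], the rank bound 'log D(N) ≥ S(σ)' of [cite: SchuchEtAl2008, eq. (5)]) and
  **`shannonEnt_le_binEntropy_add`** (grouping bound `S(p) ≤ h(ε) + (1−ε) log D + ε log (n − D)`
  for any kept set of size `D` with tail `ε` [cite: NielsenChuang2010, Thm 11.8 (4) eq. (11.57)
  with Thm 11.8 (2), p. 513]) — the classical halves of the von Neumann argument of
  [cite: SchuchEtAl2008, eq. (5)]; the Audenaert–Fannes continuity step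
  `|S(ρ) − S(σ)| ≤ T log(K−1) + H(T, 1−T)` used there is NOT formalised here (Mathlib's
  `Real.qaryEntropy K T` is exactly its right-hand side).
* Bridges to `TruncatedStateFidelity`: with `p k = ‖c k‖²`, `Σ‖c_k‖² = 1`:
  `log_card_ge_renyiEnt_add_log_keptWeight` (α > 1, any `K`) and
  `log_card_ge_renyiEnt_add_log_overlapSq` (the same with the fidelity `|⟨ψ|φ̂_K⟩|²` of the
  renormalised truncation, via `overlapSq_truncUnit`: a rank-`D` truncation of fidelity `F` needs
  `D ≥ e^{S_α} F^{α/(α−1)}`), `discardedWeight_rpow_mul_le` (0 < α < 1, `K` a top set),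
  `shannonEnt_schmidt_le`.

Not covered: Lemma 1 of [VerstraeteCirac2006] (`‖ψ − ψ_D‖² ≤ 2 Σ_k ε_k(D)`, the MPS construction by
successive Schmidt truncations — an operator statement about completely positive maps), the
identification of `renyiEnt (‖c ·‖²)` with `S_α` of the reduced density MATRIX (Schmidt
decomposition), and the entropy-SCALING conclusions of [SchuchEtAl2008, Table I] (statements about
families `N → ∞`). Users feed the measured / exactly computed spectrum of one cut.

## References

* [VerstraeteCirac2006] F. Verstraete, J. I. Cirac, *Matrix product states represent ground states
  faithfully*, Phys. Rev. B 73, 094423 (2006) = arXiv:cond-mat/0505140, §3.1 Lemma 1, Lemma 2 and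
  its proof. Read via `lit read paper:arxiv-cond-mat_0505140` (chunk p0006).
* [NielsenChuang2010] M. A. Nielsen, I. L. Chuang, *Quantum Computation and Quantum Information*,
  10th anniversary ed., CUP 2010: Thm 11.2 p. 506, Thm 11.8 (1), (2), (4) eq. (11.57) p. 513. Read
  via `lit read book:nielsen2010-quantum-computation-quantum-information-10th-anniversary-ed`
  (PDF pp. 591, 598).
* [SchuchEtAl2008] N. Schuch, M. M. Wolf, F. Verstraete, J. I. Cirac, *Entropy scaling and
  simulability by matrix product states*, Phys. Rev. Lett. 100, 030504 (2008) = arXiv:0705.0292,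
  eq. (4) with the chain of inequalities after it, eq. (5), and the α > 1 displays following
  eq. (5); equation numbers as in arXiv:0705.0292. Read via `lit read paper:arxiv-0705.0292`
  (chunks p0003–p0004).
-/

noncomputable section

open Finset Real

namespace Literature.Computability.QuantumComplexity

variable {ι : Type*}

/-! ### Entropies of a finite nonnegative vector -/

section Entropies

variable [Fintype ι]

/-- The power sum `Σᵢ pᵢ^α` (real power; `= tr ρ^α` evaluated on the spectrum `p` of `ρ`).
[cite: SchuchEtAl2008, display 'S_α(ρ) = log tr ρ^α / (1 − α)'] -/
def powerSum (p : ι → ℝ) (α : ℝ) : ℝ := ∑ i, p i ^ α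

/-- The Rényi entropy `S_α(p) = log (Σᵢ pᵢ^α) / (1 − α)` of a finite probability vector (natural
logarithm; junk at `α = 1`, where Lean's `x / 0 = 0`). [cite: SchuchEtAl2008, display
'S_α(ρ) = log tr ρ^α / (1 − α), 0 ≤ α ≤ ∞'; VerstraeteCirac2006, §3.1 display before Lemma 2] -/
def renyiEnt (p : ι → ℝ) (α : ℝ) : ℝ := Real.log (powerSum p α) / (1 - α)

/-- The Shannon entropy `Σᵢ η(pᵢ)`, `η(t) = −t log t`, of a finite probability vector — the von
Neumann entropy `S(ρ) = −tr[ρ log ρ]` evaluated on the spectrum. [cite: SchuchEtAl2008,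
'S(ρ) = −tr[ρ log ρ]', 'lim_{α→1} S_α(ρ) = S(ρ)'] -/
def shannonEnt (p : ι → ℝ) : ℝ := ∑ i, (p i).negMulLog

/-- Unfolding `powerSum` (`tr ρ^α` on the spectrum).
[cite: SchuchEtAl2008, display 'S_α(ρ) = log tr ρ^α / (1 − α)'] -/
theorem powerSum_def (p : ι → ℝ) (α : ℝ) : powerSum p α = ∑ i, p i ^ α := rfl

/-- Unfolding `renyiEnt`. [cite: SchuchEtAl2008, display 'S_α(ρ) = log tr ρ^α / (1 − α)'] -/
theorem renyiEnt_def (p : ι → ℝ) (α : ℝ) :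
    renyiEnt p α = Real.log (powerSum p α) / (1 - α) := rfl

/-- Unfolding `shannonEnt`. [cite: SchuchEtAl2008, 'S(ρ) = −tr[ρ log ρ]'] -/
theorem shannonEnt_def (p : ι → ℝ) : shannonEnt p = ∑ i, (p i).negMulLog := rfl

/-- `tr ρ^α = Σᵢ pᵢ^α ≥ 0` for a nonnegative vector (spectrum).
[cite: SchuchEtAl2008, display 'S_α(ρ) = log tr ρ^α / (1 − α)' (the argument of the logarithm)] -/
theorem powerSum_nonneg {p : ι → ℝ} (hp : ∀ i, 0 ≤ p i) (α : ℝ) : 0 ≤ powerSum p α :=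
  sum_nonneg fun i _ => rpow_nonneg (hp i) α

/-- A partial power sum is at most the full one (all terms are nonnegative). [folklore] -/
private theorem sum_rpow_le_powerSum {p : ι → ℝ} (hp : ∀ i, 0 ≤ p i) (α : ℝ) (K : Finset ι) :
    ∑ i ∈ K, p i ^ α ≤ powerSum p α :=
  sum_le_sum_of_subset_of_nonneg (subset_univ K) fun i _ _ => rpow_nonneg (hp i) α

/-- `(1 − α) · S_α(p) = log Σᵢ pᵢ^α` for `α ≠ 1` (the defining display, cleared of the
denominator). [cite: SchuchEtAl2008, display 'S_α(ρ) = log tr ρ^α / (1 − α)'] -/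
theorem one_sub_mul_renyiEnt {p : ι → ℝ} {α : ℝ} (hα : α ≠ 1) :
    (1 - α) * renyiEnt p α = Real.log (powerSum p α) := by
  rw [renyiEnt, mul_div_cancel₀ _ (sub_ne_zero.mpr (Ne.symm hα))]

/-- Each entry of a probability vector is at most `1`. [folklore] -/
private theorem le_one_of_sum_eq_one {p : ι → ℝ} (hp : ∀ i, 0 ≤ p i) (hp1 : ∑ i, p i = 1)
    (i : ι) : p i ≤ 1 := by
  calc p i ≤ ∑ j, p j := single_le_sum (fun j _ => hp j) (mem_univ i)
    _ = 1 := hp1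

/-- The Shannon / von Neumann entropy of a probability vector (a spectrum) is nonnegative.
[cite: NielsenChuang2010, Thm 11.8 (1), p. 513 ('The entropy is non-negative')] -/
theorem shannonEnt_nonneg {p : ι → ℝ} (hp : ∀ i, 0 ≤ p i) (hp1 : ∑ i, p i = 1) :
    0 ≤ shannonEnt p :=
  sum_nonneg fun i _ => negMulLog_nonneg (hp i) (le_one_of_sum_eq_one hp hp1 i)

end Entropies

/-! ### Keeping the largest weights: top sets and the truncation error `ε(D)` -/

/-- `K` keeps the LARGEST entries of `p`: every discarded value is at most every kept value (for the
nonincreasingly ordered spectrum `λ₁ ≥ λ₂ ≥ ⋯`, `K` = the first `#K` indices, so that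
`Σ_{i ∉ K} pᵢ = ε(#K)`). [cite: VerstraeteCirac2006, §3.1 ('sorted in decreasing order',
`ε(D) = Σ_{i=D+1} λᵢ`); SchuchEtAl2008, definition of ε_k(D)] -/
def IsTopSet (p : ι → ℝ) (K : Finset ι) : Prop := ∀ i ∈ K, ∀ j, j ∉ K → p j ≤ p i

/-- The empty kept set is (vacuously) a top set. [folklore] -/
private theorem isTopSet_empty (p : ι → ℝ) : IsTopSet p ∅ := fun _ hi => absurd hi (notMem_empty _)

section TopSets

variable [Fintype ι] [DecidableEq ι]

omit [Fintype ι] in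
/-- Adding a maximiser of `p` over the discarded indices to a top set gives a top set. [folklore] -/
private theorem IsTopSet.insert_of_isMaxOn {p : ι → ℝ} {K : Finset ι} (hK : IsTopSet p K) {j₀ : ι}
    (hj₀ : j₀ ∉ K) (hmax : ∀ j, j ∉ K → p j ≤ p j₀) : IsTopSet p (insert j₀ K) := by
  intro i hi j hj
  rw [mem_insert, not_or] at hj
  rcases mem_insert.mp hi with rfl | hiK
  · exact hmax j hj.2
  · exact hK i hiK j hj.2

/-- For every `D ≤ |ι|` there is a top set of exactly `D` indices (take the `D` largest entries,
ties broken arbitrarily). [cite: VerstraeteCirac2006, §3.1 (ordering the spectrum)] -/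
theorem exists_isTopSet_card (p : ι → ℝ) {D : ℕ} (hD : D ≤ Fintype.card ι) :
    ∃ K : Finset ι, K.card = D ∧ IsTopSet p K := by
  induction D with
  | zero => exact ⟨∅, card_empty, isTopSet_empty p⟩
  | succ D ih =>
    obtain ⟨K, hKc, hK⟩ := ih (Nat.le_of_succ_le hD)
    have hne : (univ \ K).Nonempty := by
      rw [← card_pos, card_univ_sdiff, hKc]
      omega
    obtain ⟨j₀, hj₀, hmax⟩ := exists_max_image (univ \ K) p hne
    have hj₀K : j₀ ∉ K := (mem_sdiff.mp hj₀).2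
    refine ⟨insert j₀ K, by rw [card_insert_of_notMem hj₀K, hKc], hK.insert_of_isMaxOn hj₀K ?_⟩
    exact fun j hj => hmax j (mem_sdiff.mpr ⟨mem_univ j, hj⟩)

omit [Fintype ι] in
/-- **Keeping the `D` largest weights maximises the kept weight**: if `K` is a top set of a
nonnegative vector and `#K' ≤ #K`, then `Σ_{K'} p ≤ Σ_{K} p`. (The rearrangement step behind 'the
best an MPS with bond dimension D … can do is to preserve the D largest eigenvalues'
[cite: SchuchEtAl2008, before eq. (4)].) -/
theorem sum_le_sum_of_isTopSet {p : ι → ℝ} (hp : ∀ i, 0 ≤ p i) {K : Finset ι} (hK : IsTopSet p K)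
    {K' : Finset ι} (hcard : K'.card ≤ K.card) : ∑ i ∈ K', p i ≤ ∑ i ∈ K, p i := by
  rcases K.eq_empty_or_nonempty with rfl | hne
  · rw [card_empty, Nat.le_zero, card_eq_zero] at hcard
    rw [hcard]
  obtain ⟨i₀, hi₀, hmin⟩ := exists_min_image K p hne
  -- threshold `h = p i₀`: kept entries are `≥ h`, discarded ones `≤ h`
  have hcard' : (K' \ K).card ≤ (K \ K').card := by
    have h1 := card_sdiff_add_card_inter K' K
    have h2 := card_sdiff_add_card_inter K K'
    rw [inter_comm] at h2
    omega
  have hA : ∑ i ∈ K' \ K, p i ≤ (K' \ K).card • p i₀ :=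
    sum_le_card_nsmul _ _ _ fun j hj => hK i₀ hi₀ j (mem_sdiff.mp hj).2
  have hB : (K' \ K).card • p i₀ ≤ (K \ K').card • p i₀ := nsmul_le_nsmul_left (hp i₀) hcard'
  have hC : (K \ K').card • p i₀ ≤ ∑ i ∈ K \ K', p i :=
    card_nsmul_le_sum _ _ _ fun i hi => hmin i (mem_sdiff.mp hi).1
  have h1 : ∑ i ∈ K' ∩ K, p i + ∑ i ∈ K' \ K, p i = ∑ i ∈ K', p i := sum_inter_add_sum_sdiff _ _ _
  have h2 : ∑ i ∈ K ∩ K', p i + ∑ i ∈ K \ K', p i = ∑ i ∈ K, p i := sum_inter_add_sum_sdiff _ _ _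
  rw [inter_comm] at h2
  linarith

/-- The complement form: a top set of size `D` has the LEAST discarded weight among all kept sets
of at most `D` indices — `ε(D) ≤ Σ_{i ∉ K'} pᵢ` whenever `#K' ≤ D`.
[cite: SchuchEtAl2008, before eq. (4) ('resulting in an error of ε_k(D)')] -/
theorem tail_isTopSet_le_tail {p : ι → ℝ} (hp : ∀ i, 0 ≤ p i) {K : Finset ι} (hK : IsTopSet p K)
    {K' : Finset ι} (hcard : K'.card ≤ K.card) :
    ∑ i ∈ univ \ K, p i ≤ ∑ i ∈ univ \ K', p i := by
  have h1 := sum_sdiff (f := p) (subset_univ K)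
  have h2 := sum_sdiff (f := p) (subset_univ K')
  have := sum_le_sum_of_isTopSet hp hK hcard
  linarith

/-- Kept plus discarded weight is the total. [folklore] -/
private theorem sum_sdiff_univ_add_sum (p : ι → ℝ) (K : Finset ι) :
    ∑ i ∈ univ \ K, p i + ∑ i ∈ K, p i = ∑ i, p i :=
  sum_sdiff (subset_univ K)

/-- **Classical core of [SchuchEtAl2008, eq. (4)]**: any vector `q` supported on a set `S` of
at most `D = #K` indices (the spectrum of a rank-`≤ D` state `σ_{D,k}`, in the commuting position
to which step (ii) of the printed proof reduces the general case) is at `ℓ¹`-distance at least the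
truncation error from `p`: `Σᵢ |pᵢ − qᵢ| ≥ Σ_{i ∉ S} pᵢ ≥ ε(D)`.
[cite: SchuchEtAl2008, eq. (4) '‖ψ − φ_D‖_tr ≥ ε_k(D) ∀k' and the chain
'‖ψ − φ_D‖_tr ≥ ‖ρ_k − σ_{D,k}‖_tr ≥ ε_k(D)' after it, with 'iii) rank σ_{D,k} ≤ D'] -/
theorem tail_le_l1Dist_of_support_card_le {p : ι → ℝ} (hp : ∀ i, 0 ≤ p i) {K : Finset ι}
    (hK : IsTopSet p K) (q : ι → ℝ) {S : Finset ι} (hq : ∀ i, i ∉ S → q i = 0)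
    (hS : S.card ≤ K.card) : ∑ i ∈ univ \ K, p i ≤ ∑ i, |p i - q i| :=
  calc ∑ i ∈ univ \ K, p i ≤ ∑ i ∈ univ \ S, p i := tail_isTopSet_le_tail hp hK hS
    _ = ∑ i ∈ univ \ S, |p i - q i| :=
        sum_congr rfl fun i hi => by
          rw [hq i (mem_sdiff.mp hi).2, sub_zero, abs_of_nonneg (hp i)]
    _ ≤ ∑ i, |p i - q i| :=
        sum_le_sum_of_subset_of_nonneg (subset_univ _) fun i _ _ => abs_nonneg _

end TopSets

/-! ### Rényi entropies with `α > 1`: a lower bound on the bond dimension (Schuch et al.) -/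

section RenyiLarge

variable [Fintype ι] [DecidableEq ι]

omit [Fintype ι] [DecidableEq ι] in
/-- **Power-mean step.** For `1 ≤ α` and a nonempty block `K` of size `D` and mass
`P = Σ_{i∈K} pᵢ`: `P^α / D^{α−1} ≤ Σ_{i∈K} pᵢ^α` (Jensen for `t ↦ t^α`; equality for the flat block
`pᵢ = P/D`, the majorising distribution of the printed proof). [cite: SchuchEtAl2008, α > 1
paragraph after eq. (5): 'the probability distribution p₁, …, p_D = (1−ε)/D; p_{D+1}, … =
ε/(2^L − D) … has maximal entropy'] -/
theorem keptMass_rpow_div_le_sum_rpow {p : ι → ℝ} (hp : ∀ i, 0 ≤ p i) {α : ℝ} (hα : 1 ≤ α)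
    {K : Finset ι} (hK : K.Nonempty) :
    (∑ i ∈ K, p i) ^ α / (K.card : ℝ) ^ (α - 1) ≤ ∑ i ∈ K, p i ^ α := by
  have hD : (0 : ℝ) < K.card := Nat.cast_pos.mpr hK.card_pos
  have hP : 0 ≤ ∑ i ∈ K, p i := sum_nonneg fun i _ => hp i
  have hw : ∑ i ∈ K, (fun _ => (K.card : ℝ)⁻¹) i = 1 := by
    rw [sum_const, nsmul_eq_mul, mul_inv_cancel₀ hD.ne']
  have hj := Real.rpow_arith_mean_le_arith_mean_rpow K (fun _ => (K.card : ℝ)⁻¹) p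
    (fun _ _ => inv_nonneg.mpr hD.le) hw (fun i _ => hp i) hα
  rw [← mul_sum, ← mul_sum, inv_mul_eq_div, inv_mul_eq_div, Real.div_rpow hP hD.le] at hj
  -- hj : P^α / D^α ≤ (Σ p^α) / D
  rw [Real.rpow_sub_one hD.ne', div_div_eq_mul_div, mul_div_right_comm]
  exact (le_div_iff₀ hD).mp hj

/-- **[SchuchEtAl2008, first display of the α > 1 argument]**: splitting a probability vector into a
kept block `K` (size `D`, mass `1 − ε`) and its complement (size `n − D`, mass `ε`),
`Σᵢ pᵢ^α ≥ (1−ε)^α / D^{α−1} + ε^α / (n−D)^{α−1}` for `α ≥ 1` (both blocks nonempty).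
[cite: SchuchEtAl2008, display
'S_α(ρ_N^L) ≤ (−1/(α−1)) log[(1−ε)^α/D^{α−1} + ε^α/(2^L−D)^{α−1}]' after eq. (5)] -/
theorem powerSum_ge_two_blocks {p : ι → ℝ} (hp : ∀ i, 0 ≤ p i) {α : ℝ} (hα : 1 ≤ α)
    {K : Finset ι} (hK : K.Nonempty) (hKc : (univ \ K).Nonempty) :
    (∑ i ∈ K, p i) ^ α / (K.card : ℝ) ^ (α - 1)
      + (∑ i ∈ univ \ K, p i) ^ α / ((univ \ K).card : ℝ) ^ (α - 1) ≤ powerSum p α := by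
  rw [powerSum, ← sum_inter_add_sum_sdiff univ K (fun i => p i ^ α), univ_inter]
  exact add_le_add (keptMass_rpow_div_le_sum_rpow hp hα hK)
    (keptMass_rpow_div_le_sum_rpow hp hα hKc)

omit [DecidableEq ι] in
/-- **Bond-dimension lower bound from a Rényi entropy with `α > 1` [SchuchEtAl2008].** For ANY kept
set `K` of size `D ≥ 1` with kept mass `P = Σ_{i∈K} pᵢ > 0` (for a probability vector,
`P = 1 − ε` with `ε` the discarded weight):
`S_α(p) + (α/(α−1)) log P ≤ log D`, i.e. `S_α(p) ≤ log D − (α/(α−1)) log (1 − ε)`.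
[cite: SchuchEtAl2008, displays after eq. (5):
'… ≤ (−1/(α−1)) log[(1−ε)^α/D^{α−1}] = log D − (α/(α−1)) log(1−ε)' and
'log D ≥ S_α(ρ_N^L) + (α/(α−1)) ⋯ log(1−δ)'] (The printed last line writes `+ (α/(α−1))|log(1−δ)|`;
the inequality that follows from the display before it, and the one proved here, has
`+ (α/(α−1)) log(1−ε) = −(α/(α−1))|log(1−ε)|`.) No ordering hypothesis on `K` is needed in this
direction. -/
theorem log_card_ge_renyiEnt_add {p : ι → ℝ} (hp : ∀ i, 0 ≤ p i) {α : ℝ} (hα : 1 < α)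
    {K : Finset ι} (hK : K.Nonempty) (hP : 0 < ∑ i ∈ K, p i) :
    renyiEnt p α + α / (α - 1) * Real.log (∑ i ∈ K, p i) ≤ Real.log K.card := by
  set P := ∑ i ∈ K, p i with hPdef
  have hD : (0 : ℝ) < K.card := Nat.cast_pos.mpr hK.card_pos
  have hS : P ^ α / (K.card : ℝ) ^ (α - 1) ≤ powerSum p α :=
    (keptMass_rpow_div_le_sum_rpow hp hα.le hK).trans (sum_rpow_le_powerSum hp α K)
  have hpos : 0 < P ^ α / (K.card : ℝ) ^ (α - 1) :=
    div_pos (rpow_pos_of_pos hP α) (rpow_pos_of_pos hD _)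
  have hlog : α * Real.log P - (α - 1) * Real.log K.card ≤ Real.log (powerSum p α) := by
    have h := Real.log_le_log hpos hS
    rwa [Real.log_div (rpow_pos_of_pos hP α).ne' (rpow_pos_of_pos hD _).ne', Real.log_rpow hP,
      Real.log_rpow hD] at h
  have hneg : 1 - α < 0 := by linarith
  have hne : α - 1 ≠ 0 := by linarith
  have h1 : renyiEnt p α ≤ Real.log K.card - α / (α - 1) * Real.log P := by
    rw [renyiEnt, div_le_iff_of_neg hneg]
    have : (Real.log K.card - α / (α - 1) * Real.log P) * (1 - α)
        = α * Real.log P - (α - 1) * Real.log K.card := by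
      field_simp
      ring
    rw [this]
    exact hlog
  linarith

omit [DecidableEq ι] in
/-- Exponential form of `log_card_ge_renyiEnt_add`: `D ≥ e^{S_α(p)} · P^{α/(α−1)}` for `α > 1`
(e.g. `α = 2`: `D ≥ e^{S₂} (1−ε)²` — a truncation to `D` states with discarded weight `ε` is only
possible if the collision entropy allows it).
[cite: SchuchEtAl2008, after eq. (5) ('we infer that D has to grow exponentially')] -/
theorem card_ge_exp_renyiEnt_mul {p : ι → ℝ} (hp : ∀ i, 0 ≤ p i) {α : ℝ} (hα : 1 < α)
    {K : Finset ι} (hK : K.Nonempty) (hP : 0 < ∑ i ∈ K, p i) :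
    Real.exp (renyiEnt p α) * (∑ i ∈ K, p i) ^ (α / (α - 1)) ≤ K.card := by
  have h := log_card_ge_renyiEnt_add hp hα hK hP
  have hD : (0 : ℝ) < K.card := Nat.cast_pos.mpr hK.card_pos
  calc Real.exp (renyiEnt p α) * (∑ i ∈ K, p i) ^ (α / (α - 1))
        = Real.exp (renyiEnt p α + α / (α - 1) * Real.log (∑ i ∈ K, p i)) := by
          rw [Real.exp_add, Real.rpow_def_of_pos hP, mul_comm (Real.log _)]
    _ ≤ Real.exp (Real.log K.card) := Real.exp_le_exp.mpr h
    _ = K.card := Real.exp_log hD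

end RenyiLarge

/-! ### Rényi entropies with `0 < α < 1`: an upper bound on the truncation error
  (Verstraete–Cirac, Lemma 2) -/

section RenyiSmall

variable [Fintype ι] [DecidableEq ι]

/-- **[VerstraeteCirac2006, Lemma 2], multiplicative form.** For `0 < α < 1` and a TOP set `K` of
`D ≥ 1` indices (the `D` largest weights) with tail `ε = Σ_{i∉K} pᵢ = ε(D)`:
`ε^α · D^{1−α} ≤ (1−α)^{1−α} α^α · Σᵢ pᵢ^α`.
Proof as printed, with the majorisation step replaced by the direct threshold estimate: for
`h = min_K p`, kept entries are `≥ h` and discarded ones `≤ h`, so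
`Σᵢ pᵢ^α ≥ D h^α + ε h^{α−1}` [cite: VerstraeteCirac2006, proof of Lemma 2:
'Σᵢ pᵢ^α ≥ D h^α + p h^{α−1}'], and the weighted AM–GM inequality with weights `(1−α, α)` gives
`D h^α + ε h^{α−1} ≥ D^{1−α} ε^α / ((1−α)^{1−α} α^α)` for every `h > 0` [cite: VerstraeteCirac2006,
proof of Lemma 2: 'Minimizing this expression with relation to h, we get
Σᵢ pᵢ^α ≥ (D^{1−α} p^α)/((1−α)^{1−α} α^α)']. -/
theorem tail_rpow_mul_card_rpow_le {p : ι → ℝ} (hp : ∀ i, 0 ≤ p i) {α : ℝ} (hα0 : 0 < α)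
    (hα1 : α < 1) {K : Finset ι} (hK : IsTopSet p K) (hKne : K.Nonempty) :
    (∑ i ∈ univ \ K, p i) ^ α * (K.card : ℝ) ^ (1 - α)
      ≤ (1 - α) ^ (1 - α) * α ^ α * powerSum p α := by
  obtain ⟨i₀, hi₀, hmin⟩ := exists_min_image K p hKne
  set h := p i₀ with hh
  set ε := ∑ i ∈ univ \ K, p i with hε
  set D := (K.card : ℝ) with hDdef
  have hD : 0 < D := Nat.cast_pos.mpr hKne.card_pos
  have hεnn : 0 ≤ ε := sum_nonneg fun i _ => hp i
  have h0 : 0 ≤ h := hp i₀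
  have h1α : 0 < 1 - α := sub_pos.mpr hα1
  have hc : 0 ≤ (1 - α) ^ (1 - α) * α ^ α :=
    mul_nonneg (rpow_nonneg h1α.le _) (rpow_nonneg hα0.le _)
  rcases h0.eq_or_lt with hz | hpos
  · -- `h = 0`: every discarded entry is `≤ 0`, so `ε = 0`
    have hε0 : ε = 0 := by
      refine sum_eq_zero fun j hj => le_antisymm ?_ (hp j)
      have hjle := hK i₀ hi₀ j (mem_sdiff.mp hj).2
      rwa [← hh, ← hz] at hjle
    rw [hε0, Real.zero_rpow hα0.ne', zero_mul]
    exact mul_nonneg hc (powerSum_nonneg hp α)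
  · -- `h > 0`
    set A := D * h ^ α with hAdef
    set B := ε * h ^ (α - 1) with hBdef
    have hA0 : 0 ≤ A := mul_nonneg hD.le (rpow_nonneg h0 _)
    have hB0 : 0 ≤ B := mul_nonneg hεnn (rpow_nonneg h0 _)
    -- (a) kept block
    have hA : A ≤ ∑ i ∈ K, p i ^ α := by
      have h1 := card_nsmul_le_sum K (fun i => p i ^ α) (h ^ α)
        fun i hi => Real.rpow_le_rpow h0 (hmin i hi) hα0.le
      rwa [nsmul_eq_mul] at h1
    -- (b) discarded block
    have hB : B ≤ ∑ i ∈ univ \ K, p i ^ α := by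
      rw [hBdef, hε, sum_mul]
      refine sum_le_sum fun j hj => ?_
      have hjle : p j ≤ h := hK i₀ hi₀ j (mem_sdiff.mp hj).2
      rcases (hp j).eq_or_lt with hj0 | hjpos
      · rw [← hj0, zero_mul, Real.zero_rpow hα0.ne']
      · have hsplit : p j ^ α = p j * p j ^ (α - 1) := by
          conv_lhs => rw [show α = 1 + (α - 1) by ring]
          rw [Real.rpow_add hjpos, Real.rpow_one]
        rw [hsplit]
        exact mul_le_mul_of_nonneg_left
          (Real.rpow_le_rpow_of_nonpos hjpos hjle (by linarith)) (hp j)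
    have hsum : A + B ≤ powerSum p α := by
      calc A + B ≤ ∑ i ∈ K, p i ^ α + ∑ i ∈ univ \ K, p i ^ α := add_le_add hA hB
        _ = powerSum p α := by
            rw [powerSum, ← sum_inter_add_sum_sdiff univ K (fun i => p i ^ α), univ_inter]
    -- (c) weighted AM–GM at weights `(1 − α, α)` applied to `A/(1−α)`, `B/α`
    have hamgm := Real.geom_mean_le_arith_mean2_weighted h1α.le hα0.le (div_nonneg hA0 h1α.le)
      (div_nonneg hB0 hα0.le) (by ring : (1 - α) + α = 1)
    have hr : (1 - α) * (A / (1 - α)) + α * (B / α) = A + B := by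
      rw [mul_div_cancel₀ _ h1α.ne', mul_div_cancel₀ _ hα0.ne']
    have hl : (1 - α) ^ (1 - α) * α ^ α * ((A / (1 - α)) ^ (1 - α) * (B / α) ^ α)
        = ε ^ α * D ^ (1 - α) := by
      calc (1 - α) ^ (1 - α) * α ^ α * ((A / (1 - α)) ^ (1 - α) * (B / α) ^ α)
          = ((1 - α) * (A / (1 - α))) ^ (1 - α) * (α * (B / α)) ^ α := by
            rw [Real.mul_rpow h1α.le (div_nonneg hA0 h1α.le),
              Real.mul_rpow hα0.le (div_nonneg hB0 hα0.le)]
            ring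
        _ = A ^ (1 - α) * B ^ α := by rw [mul_div_cancel₀ _ h1α.ne', mul_div_cancel₀ _ hα0.ne']
        _ = D ^ (1 - α) * (h ^ α) ^ (1 - α) * (ε ^ α * (h ^ (α - 1)) ^ α) := by
            rw [hAdef, hBdef, Real.mul_rpow hD.le (rpow_nonneg h0 _),
              Real.mul_rpow hεnn (rpow_nonneg h0 _)]
        _ = ε ^ α * D ^ (1 - α) * ((h ^ α) ^ (1 - α) * (h ^ (α - 1)) ^ α) := by ring
        _ = ε ^ α * D ^ (1 - α) := by
            rw [← Real.rpow_mul h0, ← Real.rpow_mul h0, ← Real.rpow_add hpos,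
              show α * (1 - α) + (α - 1) * α = 0 by ring, Real.rpow_zero, mul_one]
    calc ε ^ α * D ^ (1 - α)
        = (1 - α) ^ (1 - α) * α ^ α * ((A / (1 - α)) ^ (1 - α) * (B / α) ^ α) := hl.symm
      _ ≤ (1 - α) ^ (1 - α) * α ^ α * (A + B) := by
          rw [← hr]
          exact mul_le_mul_of_nonneg_left hamgm hc
      _ ≤ (1 - α) ^ (1 - α) * α ^ α * powerSum p α := mul_le_mul_of_nonneg_left hsum hc

/-- **[VerstraeteCirac2006, Lemma 2], logarithmic form (sharp version).** For `0 < α < 1`, a top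
set `K` of `D ≥ 1` indices and a positive tail `ε = ε(D) > 0`:
`log ε ≤ ((1−α)/α) · (S_α(p) − log (D/(1−α))) + log α`.
[cite: VerstraeteCirac2006, proof of Lemma 2: 'p ≤ exp(((1−α)/α)(S^α(p,D) − log(D/(1−α))))' —
printed after dropping the term `log α ≤ 0`, see `log_tail_le`] -/
theorem log_tail_le_sharp {p : ι → ℝ} (hp : ∀ i, 0 ≤ p i) {α : ℝ} (hα0 : 0 < α) (hα1 : α < 1)
    {K : Finset ι} (hK : IsTopSet p K) (hKne : K.Nonempty) (hε : 0 < ∑ i ∈ univ \ K, p i) :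
    Real.log (∑ i ∈ univ \ K, p i)
      ≤ (1 - α) / α * (renyiEnt p α - Real.log (K.card / (1 - α))) + Real.log α := by
  set ε := ∑ i ∈ univ \ K, p i with hεdef
  have hD : (0 : ℝ) < K.card := Nat.cast_pos.mpr hKne.card_pos
  have h1α : 0 < 1 - α := sub_pos.mpr hα1
  have hmain := tail_rpow_mul_card_rpow_le hp hα0 hα1 hK hKne
  have hlhs : 0 < ε ^ α * (K.card : ℝ) ^ (1 - α) :=
    mul_pos (rpow_pos_of_pos hε α) (rpow_pos_of_pos hD _)
  have hc : 0 ≤ (1 - α) ^ (1 - α) * α ^ α :=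
    mul_nonneg (rpow_nonneg h1α.le _) (rpow_nonneg hα0.le _)
  -- the power sum is positive (the left-hand side of `hmain` is)
  have hS : 0 < powerSum p α := by
    by_contra hS
    have := mul_nonpos_of_nonneg_of_nonpos hc (not_lt.mp hS)
    linarith
  have hlog := Real.log_le_log hlhs hmain
  rw [Real.log_mul (rpow_pos_of_pos hε α).ne' (rpow_pos_of_pos hD _).ne',
    Real.log_mul (mul_pos (rpow_pos_of_pos h1α _) (rpow_pos_of_pos hα0 _)).ne' hS.ne',
    Real.log_mul (rpow_pos_of_pos h1α _).ne' (rpow_pos_of_pos hα0 _).ne',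
    Real.log_rpow hε, Real.log_rpow hD, Real.log_rpow h1α, Real.log_rpow hα0,
    ← one_sub_mul_renyiEnt hα1.ne] at hlog
  -- hlog : α log ε + (1−α) log D ≤ (1−α) log(1−α) + α log α + (1−α) S_α
  rw [Real.log_div hD.ne' h1α.ne']
  have key : α * Real.log ε ≤ α * ((1 - α) / α * (renyiEnt p α
      - (Real.log K.card - Real.log (1 - α))) + Real.log α) := by
    have : α * ((1 - α) / α * (renyiEnt p α - (Real.log K.card - Real.log (1 - α))) + Real.log α)
        = (1 - α) * (renyiEnt p α - (Real.log K.card - Real.log (1 - α))) + α * Real.log α := by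
      field_simp
    rw [this]
    linarith
  exact le_of_mul_le_mul_left key hα0

/-- **[VerstraeteCirac2006, Lemma 2] as printed**: 'Given a density operator ρ. If 0 < α < 1, then
log(ε(D)) ≤ ((1−α)/α) (S^α(ρ) − log (D/(1−α)))', for the spectrum `p` of `ρ`, `K` the `D ≥ 1`
largest weights and `ε(D) = Σ_{i∉K} pᵢ > 0` (for `ε(D) = 0` there is nothing to bound; recall
`Real.log 0 = 0` in Lean, so positivity is a genuine hypothesis of this form — use
`tail_rpow_mul_card_rpow_le` otherwise). [cite: VerstraeteCirac2006, Lemma 2] -/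
theorem log_tail_le {p : ι → ℝ} (hp : ∀ i, 0 ≤ p i) {α : ℝ} (hα0 : 0 < α) (hα1 : α < 1)
    {K : Finset ι} (hK : IsTopSet p K) (hKne : K.Nonempty) (hε : 0 < ∑ i ∈ univ \ K, p i) :
    Real.log (∑ i ∈ univ \ K, p i)
      ≤ (1 - α) / α * (renyiEnt p α - Real.log (K.card / (1 - α))) := by
  have h := log_tail_le_sharp hp hα0 hα1 hK hKne hε
  have hlogα : Real.log α ≤ 0 := Real.log_nonpos hα0.le hα1.le
  linarith

end RenyiSmall

/-! ### The von Neumann (Shannon) entropy: rank and grouping bounds -/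

section Shannon

variable [Fintype ι] [DecidableEq ι]

omit [Fintype ι] [DecidableEq ι] in
/-- **One block.** For a nonnegative vector and any block `K` with mass `P = Σ_{i∈K} pᵢ`:
`Σ_{i∈K} η(pᵢ) ≤ P log #K + η(P)` (`η = −t log t`; equality for the flat block). Since
`Σ_{i∈K} η(pᵢ) = P · H(p|_K / P) + η(P)`, this is 'H(X) ≤ log d' for the conditional distribution on
the block [cite: NielsenChuang2010, Thm 11.2, p. 506 ('Suppose X is a random variable with d
outcomes. Then H(X) ≤ log d')], proved here by Jensen for the concave `η`; it is the von Neumann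
counterpart of the majorising flat block of [cite: SchuchEtAl2008, α > 1 paragraph after eq. (5)].
-/
theorem sum_negMulLog_le {p : ι → ℝ} (hp : ∀ i, 0 ≤ p i) (K : Finset ι) :
    ∑ i ∈ K, (p i).negMulLog
      ≤ (∑ i ∈ K, p i) * Real.log K.card + (∑ i ∈ K, p i).negMulLog := by
  rcases K.eq_empty_or_nonempty with rfl | hK
  · simp
  have hD : (0 : ℝ) < K.card := Nat.cast_pos.mpr hK.card_pos
  have hw : ∑ i ∈ K, (fun _ => (K.card : ℝ)⁻¹) i = 1 := by
    rw [sum_const, nsmul_eq_mul, mul_inv_cancel₀ hD.ne']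
  have hj := Real.concaveOn_negMulLog.le_map_sum (t := K) (w := fun _ => (K.card : ℝ)⁻¹) (p := p)
    (fun _ _ => inv_nonneg.mpr hD.le) hw (fun i _ => Set.mem_Ici.mpr (hp i))
  simp only [smul_eq_mul] at hj
  rw [← mul_sum, ← mul_sum, Real.negMulLog_mul] at hj
  have hinv : ((K.card : ℝ)⁻¹).negMulLog = (K.card : ℝ)⁻¹ * Real.log K.card := by
    rw [Real.negMulLog, Real.log_inv]
    ring
  rw [hinv] at hj
  -- hj : D⁻¹ Σ η(pᵢ) ≤ P (D⁻¹ log D) + D⁻¹ η(P); multiply by D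
  have h2 := mul_le_mul_of_nonneg_left hj hD.le
  rw [← mul_assoc, mul_inv_cancel₀ hD.ne', one_mul] at h2
  calc ∑ i ∈ K, (p i).negMulLog
      ≤ K.card * ((∑ i ∈ K, p i) * ((K.card : ℝ)⁻¹ * Real.log K.card)
          + (K.card : ℝ)⁻¹ * (∑ i ∈ K, p i).negMulLog) := h2
    _ = (∑ i ∈ K, p i) * Real.log K.card + (∑ i ∈ K, p i).negMulLog := by
        field_simp

omit [DecidableEq ι] in
/-- **Rank bound** (`S(σ) ≤ log rank σ`): a probability vector supported on `S` has Shannon entropy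
`≤ log #S` [cite: NielsenChuang2010, Thm 11.2, p. 506 ('H(X) ≤ log d') and Thm 11.8 (2), p. 513
('In a d-dimensional Hilbert space the entropy is at most log d')]. This is the step
'log D(N) ≥ S(σ^L_{N,D})' of [cite: SchuchEtAl2008, eq. (5)] on the spectrum of the rank-`≤ D`
reduced state of a `D`-MPS. -/
theorem shannonEnt_le_log_card_of_support {p : ι → ℝ} (hp : ∀ i, 0 ≤ p i) (hp1 : ∑ i, p i = 1)
    {S : Finset ι} (hS : ∀ i, i ∉ S → p i = 0) : shannonEnt p ≤ Real.log S.card := by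
  have hsplit : ∑ i ∈ S, (p i).negMulLog = shannonEnt p :=
    sum_subset (subset_univ S) fun i _ hi => by rw [hS i hi, Real.negMulLog_zero]
  have hPS : ∑ i ∈ S, p i = 1 := by
    rw [← hp1]
    exact sum_subset (subset_univ S) fun i _ hi => hS i hi
  rw [← hsplit]
  calc ∑ i ∈ S, (p i).negMulLog
      ≤ (∑ i ∈ S, p i) * Real.log S.card + (∑ i ∈ S, p i).negMulLog := sum_negMulLog_le hp S
    _ = Real.log S.card := by rw [hPS, one_mul, Real.negMulLog_one, add_zero]

/-- **Grouping bound.** For a probability vector and ANY kept set `K` of size `D` with discarded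
weight `ε = Σ_{i∉K} pᵢ` (on `n − D` indices):
`S(p) ≤ h(ε) + (1 − ε) log D + ε log (n − D)`, `h` = binary entropy (`Real.binEntropy`): the
grouping identity `S(Σᵢ pᵢ ρᵢ) = H(pᵢ) + Σᵢ pᵢ S(ρᵢ)` for the two orthogonally supported blocks
(kept / discarded) [cite: NielsenChuang2010, Thm 11.8 (4) eq. (11.57), p. 513] followed by
`S ≤ log d` on each block [cite: NielsenChuang2010, Thm 11.8 (2), p. 513]. Contrapositively, a
truncation to `D` states with discarded weight `ε` requires
`(1 − ε) log D ≥ S(p) − h(ε) − ε log(n − D)`. Classical skeleton of the von Neumann argument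
'log D(N) ≥ S(σ) ≥ S(ρ) − ½ δ L log d − 1' of [cite: SchuchEtAl2008, eq. (5)] (whose continuity
step, Audenaert–Fannes, is not formalised here). -/
theorem shannonEnt_le_binEntropy_add {p : ι → ℝ} (hp : ∀ i, 0 ≤ p i) (hp1 : ∑ i, p i = 1)
    (K : Finset ι) :
    shannonEnt p ≤ Real.binEntropy (∑ i ∈ univ \ K, p i) + (∑ i ∈ K, p i) * Real.log K.card
      + (∑ i ∈ univ \ K, p i) * Real.log (univ \ K).card := by
  have hsplit : shannonEnt p = ∑ i ∈ K, (p i).negMulLog + ∑ i ∈ univ \ K, (p i).negMulLog := by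
    rw [shannonEnt, ← sum_inter_add_sum_sdiff univ K (fun i => (p i).negMulLog), univ_inter]
  have hPK : ∑ i ∈ K, p i = 1 - ∑ i ∈ univ \ K, p i := by
    have := sum_sdiff_univ_add_sum p K
    linarith
  have h1 := sum_negMulLog_le hp K
  have h2 := sum_negMulLog_le hp (univ \ K)
  rw [hsplit, Real.binEntropy_eq_negMulLog_add_negMulLog_one_sub, ← hPK]
  linarith

end Shannon

/-! ### Bridges to `TruncatedStateFidelity` (Schmidt weights `pₖ = ‖cₖ‖²`) -/

section Schmidt

variable {κ : Type*} [Fintype κ] [DecidableEq κ]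

omit [DecidableEq κ] in
/-- `log_card_ge_renyiEnt_add` for Schmidt weights: for `α > 1` and any kept set `K` of `D ≥ 1`
Schmidt vectors with kept weight `p_K > 0` (`= |⟨ψ|φ̂_K⟩|²`, `overlapSq_truncUnit`),
`S_α(‖c‖²) + (α/(α−1)) log p_K ≤ log D`. [cite: SchuchEtAl2008, α > 1 displays after eq. (5)] -/
theorem log_card_ge_renyiEnt_add_log_keptWeight (c : κ → ℂ) {α : ℝ} (hα : 1 < α)
    {K : Finset κ} (hK : K.Nonempty) (hP : 0 < keptWeight c K) :
    renyiEnt (fun k => ‖c k‖ ^ 2) α + α / (α - 1) * Real.log (keptWeight c K)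
      ≤ Real.log K.card :=
  log_card_ge_renyiEnt_add (fun k => sq_nonneg ‖c k‖) hα hK hP

omit [DecidableEq κ] in
/-- The same with the FIDELITY of the renormalised truncation in place of the kept weight:
`S_α(‖c‖²) + (α/(α−1)) log |⟨ψ|φ̂_K⟩|² ≤ log #K` for `α > 1` — a rank-`D` truncation of fidelity
`F` needs `D ≥ e^{S_α} F^{α/(α−1)}`. [cite: SchuchEtAl2008, α > 1 displays after eq. (5); Xiang2023,
§7.3 eq. (7.31) for `|⟨ψ|φ̂_K⟩|² = p_K`] -/
theorem log_card_ge_renyiEnt_add_log_overlapSq {ι' : Type*} [Fintype ι'] [DecidableEq κ]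
    {w : κ → ι' → ℂ} (hw : IsOrthonormalFamily w) (c : κ → ℂ) {α : ℝ} (hα : 1 < α)
    {K : Finset κ} (hK : K.Nonempty) (hP : 0 < keptWeight c K) :
    renyiEnt (fun k => ‖c k‖ ^ 2) α
        + α / (α - 1) * Real.log (overlapSq (superpose w c univ) (truncUnit w c K))
      ≤ Real.log K.card := by
  rw [overlapSq_truncUnit hw c hP]
  exact log_card_ge_renyiEnt_add_log_keptWeight c hα hK hP

/-- `tail_rpow_mul_card_rpow_le` for Schmidt weights: for `0 < α < 1` and `K` the `D ≥ 1` largest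
Schmidt weights, `ε_K^α · D^{1−α} ≤ (1−α)^{1−α} α^α · Σₖ ‖cₖ‖^{2α}`.
[cite: VerstraeteCirac2006, Lemma 2] -/
theorem discardedWeight_rpow_mul_le (c : κ → ℂ) {α : ℝ} (hα0 : 0 < α) (hα1 : α < 1)
    {K : Finset κ} (hK : IsTopSet (fun k => ‖c k‖ ^ 2) K) (hKne : K.Nonempty) :
    discardedWeight c K ^ α * (K.card : ℝ) ^ (1 - α)
      ≤ (1 - α) ^ (1 - α) * α ^ α * powerSum (fun k => ‖c k‖ ^ 2) α :=
  tail_rpow_mul_card_rpow_le (fun k => sq_nonneg ‖c k‖) hα0 hα1 hK hKne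

/-- `shannonEnt_le_binEntropy_add` for normalised Schmidt weights: for any kept set `K`,
`S(‖c‖²) ≤ h(ε_K) + p_K log #K + ε_K log #(univ ∖ K)`. [cite: NielsenChuang2010, Thm 11.8 (4)
eq. (11.57) and Thm 11.8 (2), p. 513; SchuchEtAl2008, eq. (5) (classical skeleton)] -/
theorem shannonEnt_schmidt_le (c : κ → ℂ) (hc : ∑ k, ‖c k‖ ^ 2 = 1) (K : Finset κ) :
    shannonEnt (fun k => ‖c k‖ ^ 2) ≤ Real.binEntropy (discardedWeight c K)
      + keptWeight c K * Real.log K.card + discardedWeight c K * Real.log (univ \ K).card :=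
  shannonEnt_le_binEntropy_add (fun k => sq_nonneg ‖c k‖) hc K

end Schmidt

end Literature.Computability.QuantumComplexity
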